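import Summits.ABC.IUTFork.Thm311RealInd1Strip
import Summits.ABC.IUTFork.Thm311RealInd2IsmZHat
import Summits.ABC.IUTFork.Thm311RealInd2IsmRigid
import Literature.AnabelianGeometry.AbsoluteAnabelian.MonoAnalyticLiftNormCompat
import Literature.AnabelianGeometry.AbsoluteAnabelian.GaloisPadicLogPadicUnits
import HarnessLib

/-!
# [IUTchIII] Theorem 3.11 (i) (Ind1), print-literal at `v ∈ 𝕍^non`: NORM RIGIDITY of the strip part and
# [IUTchII] Remark 1.8.1 at the real log-shell — print's (Ind1) strip automorphisms contain NO scalar `≠ 1`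

Record file (D-0012) of the abc-iut cell (seat abc-iut-c312-1, holder of record of the typed [IUTchIII] Thm. 3.11, gen 8);
sequel of `Thm311RealInd1Strip.lean` (`Real.liftUnits v φ : 𝒪_v^× ≃* 𝒪_v^×`, the action of `φ ∈ Aut_top(G_v)` on `K_v`'s
units through THE equivariant lift; `Real.ind1StripOf v L`, the realised strip automorphisms of `K_v`).
TAKES NO SIDE on [IUTchIII] Cor. 3.12.

THE INPUT (all BY NAME, kernel-proved in the tree): abc-iut-w6-d012's `MLFClosure.norm_liftM_eq` — THE lift of `φ`
PRESERVES `N_{K_v/ℚ_p}` on `𝒪_v^×` ([AbsAnab] Prop. 1.2.1 (iii)/(vi): `ψ̄|_{k^×} = Art_k⁻¹ ∘ φ^{ab} ∘ Art_k` and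
`χ_cyc ∘ φ = χ_cyc`, with `χ_cyc ∘ Art_k = N_{k/ℚ_p}⁻¹`; the classical content of [IUTchII] Rmk. 1.8.1, kurims p. 42 l. 1–6:
«the composite with the `p`-adic logarithm of the cyclotomic character of `G` determines … a natural surjection
`O^{×μ}(G) ↠ ℚ_p`, which [cf. [AbsAnab], Proposition 1.2.1, (vi)] is `Aut(G)`-equivariant»).

PROVED here (ns `Summit.ABC.IUTFork.Thm311.Real`, `p_v := (closureAt v).residueChar`, canonical `ℚ_{p_v}`-structure
`Real.padicAlg v` = the tree's `LocalField.padicAlgebra`):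
* **`Real.norm_liftUnits`** — `N_v(liftUnits v φ u) = N_v(u)` for every `φ ∈ Aut_top(G_v)`, `u ∈ 𝒪_v^×`
  (`Real.normQp v` = `N_{K_v/ℚ_{p_v}}`); `Real.normUnits_liftUnits` (the same in `ℚ_{p_v}^×`);
* `Real.exists_pow_eq_of_galoisLog_eq` — the Galois logarithm (gen 7's `Real.galoisLog v`, abc-iut-L6-d2's `log_k̄` on
  `𝒪_v^×`) identifies exactly torsion classes: `log u = log u' ⟹ uⁿ = u'ⁿ` for some `n ≥ 1`;
* **`Real.eq_one_of_realises_zsmul`** — if an INTEGER SCALAR `m · (−)` on `K_v` realises a strip automorphism through the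
  Galois logarithm then `m = 1`; **`Real.neg_not_mem_ind1StripOf`** — `−1 ∉ Real.ind1StripOf v (galoisLog v)`: CONTRAST
  with print's (Ind2), where `−1 ∈ Real.ismIsmOf v L` for EVERY `L` (gen 7 `Real.neg_mem_ismIsmOf`), and with Dupuy–Hilado's
  `Aut_{ℚ_p}(K_v : I_v) ∋ −1`;
* **`Real.padicUnitScalar_eq_one_of_mem_ind1StripOf`** — [IUTchII] Rmk. 1.8.1 AT THE REAL LOG-SHELL: if the `Ẑ^×`-scalar
  `χ_p(û) · (−)` of print's (Ind2) (gen 7 `Real.mulPadicUnitScalar_mem_ismIsmOf`) ALSO lies in print's (Ind1) strip part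
  (both through the Galois logarithm), then `χ_p(û) = 1` in `K_v` — «no automorphism of `O^{×μ}(G)` induced by an element
  of `Aut(G)` … coincides with an automorphism … induced by an element of `Ẑ^×` that has nontrivial image in `ℤ_p^×`»,
  read on the `G_v`-invariant part (the argument of abc-iut-L6-d2's `rmk181_genuineOfModelIsm`, re-run on `𝒪_v^×`:
  `u₀ = 1 + p_v`, norms, `log(1 + p_v) ≠ 0`).

HONEST SCOPE: statements about OUR typed objects, for the GALOIS logarithm binder (the scalar exclusions are FALSE for the
degenerate inhabitant `L = 0` of the `Π`-type of logarithms, for which every bicontinuous `ψ` realises everything); the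
norm rigidity itself is binder-free.  Nothing here asserts or refutes [IUTchIII] Cor. 3.12; no side taken.
[claim: Mochizuki2012, status: disputed] for the quotations; [cite: MochizukiAbsAnab2004, Prop 1.2.1 (vi) p.10];
[cite: MochizukiAbsTopIII2015, Proposition 3.2 (iv) p.72]. typed ≠ proved elsewhere; instantiated ≠ endorsed.
-/

set_option autoImplicit false

noncomputable section

namespace Summit.ABC.IUTFork.Thm311.Real

open NumberField IsDedekindDomain Literature.IUT.LogVolume Literature.IUT.LogThetaLattice
open Literature.AnabelianGeometry.AbsoluteAnabelian Literature.IUT.HodgeArakelov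
open Literature.IUT.HodgeArakelov.AbsTopMonoids Literature.AnabelianGeometry.EtaleTheta
open Literature.NumberTheory.GaloisRepresentations

variable {F : Type} [Field F] [NumberField F] (v : HeightOneSpectrum (𝓞 F))

/-! ## 1. Norm rigidity of THE lift on `𝒪_v^×` -/

section Norm

/-! As in abc-iut-L6-d2's files and gen 7's `Thm311RealInd2IsmZHat`, the primality of `p_v := (closureAt v).residueChar` is
carried as a `Fact` binder, discharged at use sites by `(closureAt v).fact_residueChar_prime`. -/
variable [Fact (closureAt v).residueChar.Prime]

/-- The CANONICAL `ℚ_{p_v}`-algebra structure of `K_v` (the tree's `LocalField.padicAlgebra`: the unique ring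
homomorphism `ℚ_{p_v} → K_v` mapping `ℤ_{p_v}` into `𝒪_v`). [folklore] -/
abbrev padicAlg : Algebra ℚ_[(closureAt v).residueChar] (v.adicCompletion F) :=
  haveI : CharZero (v.adicCompletion F) := charZero_adicCompletion v
  LocalField.padicAlgebra (v.adicCompletion F) (closureAt v).residueChar (closureAt v).valuation_ringChar_lt_one

/-- **`N_v := N_{K_v/ℚ_{p_v}}`** for the canonical `ℚ_{p_v}`-structure, as a monoid homomorphism `K_v → ℚ_{p_v}`. [folklore] -/
def normQp : v.adicCompletion F →* ℚ_[(closureAt v).residueChar] :=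
  letI := padicAlg v
  Algebra.norm ℚ_[(closureAt v).residueChar]

/-- `N_v` on `𝒪_v^×`, valued in `ℚ_{p_v}^×`. [folklore] -/
def normUnits : (↥(v.adicCompletionIntegers F))ˣ →* ℚ_[(closureAt v).residueChar]ˣ :=
  (Units.map (normQp v)).comp (unitsToK v)

/-- `normUnits v u = N_v(u)` underneath. [folklore] -/
@[simp] theorem coe_normUnits (u : (↥(v.adicCompletionIntegers F))ˣ) :
    ((normUnits v u : ℚ_[(closureAt v).residueChar]ˣ) : ℚ_[(closureAt v).residueChar]) =
      normQp v ((u : ↥(v.adicCompletionIntegers F)) : v.adicCompletion F) := rfl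

omit [Fact (closureAt v).residueChar.Prime] in
/-- THE lift on the image of `u ∈ 𝒪_v^×` in `𝒪^⊳_{K̄_v}`, read in `K̄_v`, is the image of `liftUnits v φ u`.
[cite: MochizukiAbsTopIII2015, Proposition 3.2 (iv) p.72] -/
theorem coe_liftM_toOUnits (φ : Gal v ≃ₜ* Gal v) (u : (↥(v.adicCompletionIntegers F))ˣ) :
    ((Genuine.liftM (closureAt v) φ
        ((toOUnits v u : OUnits v) :
          nonzeroIntegers (v.adicCompletion F) (AlgebraicClosure (v.adicCompletion F))) :
        nonzeroIntegers (v.adicCompletion F) (AlgebraicClosure (v.adicCompletion F))) :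
        AlgebraicClosure (v.adicCompletion F)) =
      algebraMap (v.adicCompletion F) (AlgebraicClosure (v.adicCompletion F))
        ((liftUnits v φ u : ↥(v.adicCompletionIntegers F)) : v.adicCompletion F) := by
  rw [← coe_stripLift, stripLift_toOUnits]
  exact val_toOUnits v (liftUnits v φ u)

/-- **NORM RIGIDITY: `N_v(liftUnits v φ u) = N_v(u)`** for every topological automorphism `φ` of `G_v` and every
`u ∈ 𝒪_v^×` — abc-iut-w6-d012's `MLFClosure.norm_liftM_eq` ([AbsAnab] Prop. 1.2.1 (iii)/(vi) + `χ_cyc ∘ Art = N⁻¹`;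
[IUTchII] Rmk. 1.8.1 «`Aut(G)`-equivariant»), read on `liftUnits`. [cite: MochizukiAbsAnab2004, Prop 1.2.1 (vi) p.10] -/
theorem norm_liftUnits (φ : Gal v ≃ₜ* Gal v) (u : (↥(v.adicCompletionIntegers F))ˣ) :
    normQp v ((liftUnits v φ u : ↥(v.adicCompletionIntegers F)) : v.adicCompletion F) =
      normQp v ((u : ↥(v.adicCompletionIntegers F)) : v.adicCompletion F) := by
  have hval := val_toOUnits v u
  have hu : algebraMap (v.adicCompletion F) (AlgebraicClosure (v.adicCompletion F))
      ((u : ↥(v.adicCompletionIntegers F)) : v.adicCompletion F) ∈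
        nonzeroIntegers (v.adicCompletion F) (AlgebraicClosure (v.adicCompletion F)) := by
    rw [← hval]
    exact ((toOUnits v u : OUnits v) :
      nonzeroIntegers (v.adicCompletion F) (AlgebraicClosure (v.adicCompletion F))).2
  have harg : ((toOUnits v u : OUnits v) :
      nonzeroIntegers (v.adicCompletion F) (AlgebraicClosure (v.adicCompletion F))) = ⟨_, hu⟩ :=
    Subtype.ext hval
  have heq := coe_liftM_toOUnits v φ u
  rw [harg] at heq
  exact MLFClosure.norm_liftM_eq (closureAt v) φ _ _ hu (valuation_coe_unit v u) heq

/-- Norm rigidity in `ℚ_{p_v}^×`: `normUnits v (liftUnits v φ u) = normUnits v u`. [cite: MochizukiAbsAnab2004, Prop 1.2.1 (vi) p.10] -/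
theorem normUnits_liftUnits (φ : Gal v ≃ₜ* Gal v) (u : (↥(v.adicCompletionIntegers F))ˣ) :
    normUnits v (liftUnits v φ u) = normUnits v u :=
  Units.ext (by rw [coe_normUnits, coe_normUnits, norm_liftUnits])

/-- **The norm of units is an invariant of print's (Ind1) strip part**: for `ψ ∈ Real.ind1StripOf v L` there is a
norm-preserving automorphism `β` of `𝒪_v^×` with `ψ ∘ L = L ∘ β` on `𝒪_v^×` (namely `β = liftUnits v φ`).
[claim: Mochizuki2012, status: disputed] -/
theorem exists_normPreserving_of_mem_ind1StripOf (L : Additive (↥(v.adicCompletionIntegers F))ˣ →+ v.adicCompletion F)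
    {ψ : v.adicCompletion F ≃+ v.adicCompletion F} (hψ : ψ ∈ ind1StripOf v L) :
    ∃ β : (↥(v.adicCompletionIntegers F))ˣ ≃* (↥(v.adicCompletionIntegers F))ˣ,
      (∀ u, normUnits v (β u) = normUnits v u) ∧ ∀ u, ψ (L (Additive.ofMul u)) = L (Additive.ofMul (β u)) := by
  obtain ⟨-, -, φ, hr⟩ := hψ
  exact ⟨liftUnits v φ, normUnits_liftUnits v φ, (realises_stripMulAut_iff v L φ ψ).mp hr⟩

end Norm

/-! ## 2. The Galois logarithm identifies exactly torsion classes -/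

/-- **`log u = log u' ⟹ uⁿ = u'ⁿ` for some `n ≥ 1`** (`u, u' ∈ 𝒪_v^×`): the Galois logarithm (`Real.galoisLog v`,
abc-iut-L6-d2's `log_k̄` restricted to `𝒪_v^×`) kills exactly the roots of unity (`GaloisPadicLog.log_eq_zero_iff`).
[cite: MochizukiAbsTopIII2015, Definition 3.1 (iv) p.69] -/
theorem exists_pow_eq_of_galoisLog_eq {u u' : (↥(v.adicCompletionIntegers F))ˣ}
    (h : galoisLog v (Additive.ofMul u) = galoisLog v (Additive.ofMul u')) :
    ∃ n : ℕ, 0 < n ∧ u ^ n = u' ^ n := by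
  have h0 : galoisLog v (Additive.ofMul (u * u'⁻¹)) = 0 := by
    rw [ofMul_mul, ofMul_inv, map_add, map_neg, h, add_neg_cancel]
  have h1 := congrArg (algebraMap (v.adicCompletion F) (AlgebraicClosure (v.adicCompletion F))) h0
  rw [algebraMap_galoisLog, map_zero] at h1
  have hmem := (algebraMap_mem_invariantUnits (v.adicCompletion F) (AlgebraicClosure (v.adicCompletion F))
    (valuation_coe_unit v (u * u'⁻¹))).1
  obtain ⟨n, hn, hpow⟩ := ((closureAt v).galoisPadicLog.log_eq_zero_iff _ hmem).mp h1
  refine ⟨n, hn, ?_⟩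
  rw [← map_pow, map_eq_one_iff _ (algebraMap (v.adicCompletion F) (AlgebraicClosure (v.adicCompletion F))).injective,
    ← SubmonoidClass.coe_pow, OneMemClass.coe_eq_one, ← Units.val_pow_eq_pow_val, Units.val_eq_one, mul_pow,
    inv_pow, mul_inv_eq_one] at hpow
  exact hpow

/-! ## 3. The unit `1 + p_v` and its norm -/

section OnePlusP

variable [Fact (closureAt v).residueChar.Prime]

/-- `1 + p_v` as a `p_v`-adic unit `s₀ ∈ ℤ_{p_v}^×` (abc-iut-L6-d2's `isUnit_one_add_residueChar`). [folklore] -/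
def sZero : ℤ_[(closureAt v).residueChar]ˣ := (closureAt v).isUnit_one_add_residueChar.unit

/-- `↑(sZero v) = 1 + p_v` in `ℤ_{p_v}`. [folklore] -/
theorem coe_sZero : ((sZero v : ℤ_[(closureAt v).residueChar]ˣ) : ℤ_[(closureAt v).residueChar]) =
    1 + (((closureAt v).residueChar : ℕ) : ℤ_[(closureAt v).residueChar]) :=
  IsUnit.unit_spec _

/-- The image `t₀ ∈ K_v` of `1 + p_v` under `ℚ_{p_v} → K_v`. [folklore] -/
def tZero : v.adicCompletion F :=
  haveI : CharZero (v.adicCompletion F) := charZero_adicCompletion v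
  LocalField.padicRingHom (v.adicCompletion F) (closureAt v).residueChar (closureAt v).valuation_ringChar_lt_one
    ((sZero v : ℤ_[(closureAt v).residueChar]) : ℚ_[(closureAt v).residueChar])

/-- `t₀` is a unit of `K_v`: `|t₀|_v = 1`. [folklore] -/
theorem valuation_tZero : ValuativeRel.valuation (v.adicCompletion F) (tZero v) = 1 :=
  (closureAt v).valuation_padicRingHom_units_eq_one (closureAt v).residueChar (closureAt v).valuation_ringChar_lt_one
    (sZero v)

/-- `t₀ ≠ 0`. [folklore] -/
theorem tZero_ne_zero : tZero v ≠ 0 := by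
  intro h
  have h1 := valuation_tZero v
  rw [h, map_zero] at h1
  exact zero_ne_one h1

/-- There is a unit of `𝒪_v` with value `t₀ = 1 + p_v`. [folklore] -/
theorem exists_unit_coe_eq_tZero :
    ∃ u : (↥(v.adicCompletionIntegers F))ˣ, ((u : ↥(v.adicCompletionIntegers F)) : v.adicCompletion F) = tZero v := by
  obtain ⟨u, hu⟩ := exists_unit_coe_eq (x := Units.mk0 (tZero v) (tZero_ne_zero v))
    (by rw [Valuation.mem_unitGroup_iff]; exact valuation_tZero v)
  refine ⟨u, ?_⟩
  have h' := congrArg (fun w : (v.adicCompletion F)ˣ => (w : v.adicCompletion F)) hu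
  simpa only [coe_unitsToK, Units.val_mk0] using h'

/-- **The unit `u₀ ∈ 𝒪_v^×` with value `1 + p_v`.** [folklore] -/
def uZero : (↥(v.adicCompletionIntegers F))ˣ := (exists_unit_coe_eq_tZero v).choose

/-- `u₀ = t₀` in `K_v`. [folklore] -/
theorem coe_uZero : ((uZero v : ↥(v.adicCompletionIntegers F)) : v.adicCompletion F) = tZero v :=
  (exists_unit_coe_eq_tZero v).choose_spec

/-- In `K̄_v`, `u₀` is abc-iut-L6-d2's `padicScalar s₀`. [folklore] -/
theorem algebraMap_uZero :
    algebraMap (v.adicCompletion F) (AlgebraicClosure (v.adicCompletion F))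
        ((uZero v : ↥(v.adicCompletionIntegers F)) : v.adicCompletion F) =
      (closureAt v).padicScalar (sZero v : ℤ_[(closureAt v).residueChar]) := by
  rw [coe_uZero]
  rfl

/-- **`N_v(u₀) = (1 + p_v)^{[K_v : ℚ_{p_v}]}`** (`u₀` comes from `ℚ_{p_v}`: `Algebra.norm_algebraMap`). [folklore] -/
theorem normQp_uZero :
    normQp v ((uZero v : ↥(v.adicCompletionIntegers F)) : v.adicCompletion F) =
      letI := padicAlg v
      (((sZero v : ℤ_[(closureAt v).residueChar]ˣ) : ℤ_[(closureAt v).residueChar]) : ℚ_[(closureAt v).residueChar]) ^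
        Module.finrank ℚ_[(closureAt v).residueChar] (v.adicCompletion F) := by
  letI := padicAlg v
  rw [coe_uZero]
  exact Algebra.norm_algebraMap _

/-- `[K_v : ℚ_{p_v}]` is positive (`K_v/ℚ_{p_v}` is finite for the canonical structure, the tree's
`PadicBase.instFiniteDimensional`). [folklore] -/
theorem finrank_padicAlg_pos : letI := padicAlg v; 0 < Module.finrank ℚ_[(closureAt v).residueChar] (v.adicCompletion F) := by
  letI := padicAlg v
  haveI : CharZero (v.adicCompletion F) := charZero_adicCompletion v
  haveI : FiniteDimensional ℚ_[(closureAt v).residueChar] (v.adicCompletion F) :=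
    Literature.NumberTheory.PAdicHodge.PadicBase.instFiniteDimensional (F := v.adicCompletion F)
      (p := (closureAt v).residueChar) (closureAt v).valuation_ringChar_lt_one
  exact Module.finrank_pos

/-- `(1 + p_v)^k = 1` in `ℚ_{p_v}` forces `k = 0` (`1 + p_v > 1` in `ℕ`, characteristic `0`). [folklore] -/
theorem pow_one_add_residueChar_eq_one_iff (k : ℕ) :
    (((sZero v : ℤ_[(closureAt v).residueChar]ˣ) : ℤ_[(closureAt v).residueChar]) : ℚ_[(closureAt v).residueChar]) ^ k = 1 ↔
      k = 0 := by
  constructor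
  · intro h
    rw [coe_sZero, PadicInt.coe_add, PadicInt.coe_one, PadicInt.coe_natCast, ← Nat.cast_one, ← Nat.cast_add,
      ← Nat.cast_pow, Nat.cast_inj] at h
    rcases Nat.pow_eq_one.mp h with h | h
    · have := (Fact.out : (closureAt v).residueChar.Prime).two_le; omega
    · exact h
  · rintro rfl; rw [pow_zero]

/-- The norm `N_v(u₀) ∈ ℚ_{p_v}^×` is NOT of finite order. [folklore] -/
theorem not_isOfFinOrder_normUnits_uZero : ¬ IsOfFinOrder (normUnits v (uZero v)) := by
  intro hfin
  obtain ⟨k, hk, hpow⟩ := hfin.exists_pow_eq_one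
  have h := congrArg (fun w : ℚ_[(closureAt v).residueChar]ˣ => (w : ℚ_[(closureAt v).residueChar])) hpow
  simp only [Units.val_pow_eq_pow_val, coe_normUnits, Units.val_one] at h
  rw [normQp_uZero, ← pow_mul, pow_one_add_residueChar_eq_one_iff] at h
  exact (Nat.mul_ne_zero (finrank_padicAlg_pos v).ne' hk.ne') h

end OnePlusP

/-! ## 4. No integer scalar `≠ 1` in print's (Ind1) strip part (Galois logarithm) -/

section Scalars

variable [Fact (closureAt v).residueChar.Prime]

/-- **If the INTEGER SCALAR `m · (−)` realises a strip automorphism `φ` through the Galois logarithm, then `m = 1`.**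
Proof: `log(β u) = m · log u = log(u^m)` (`β = liftUnits v φ`), so `(β u)ⁿ = u^{mn}` for some `n ≥ 1`; taking `N_v`
(norm rigidity) at `u₀ = 1 + p_v`: `N(u₀)ⁿ = N(u₀)^{mn}` in `ℚ_{p_v}^×` with `N(u₀) = (1+p_v)^d` of infinite order, so
`n = m·n`, `m = 1`. [claim: Mochizuki2012, status: disputed] -/
theorem eq_one_of_realises_zsmul {φ : Gal v ≃ₜ* Gal v} {ψ : v.adicCompletion F ≃+ v.adicCompletion F} (m : ℤ)
    (hψm : ∀ a, ψ a = m • a) (hψ : Realises v (galoisLog v) (stripMulAut v φ) ψ) : m = 1 := by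
  rw [realises_stripMulAut_iff] at hψ
  -- `log (β u₀) = log (u₀ ^ m)`
  have h1 : galoisLog v (Additive.ofMul (liftUnits v φ (uZero v))) = galoisLog v (Additive.ofMul (uZero v ^ m)) := by
    rw [← hψ, hψm, ofMul_zpow, map_zsmul]
  obtain ⟨n, hn, hpow⟩ := exists_pow_eq_of_galoisLog_eq v h1
  -- norms: `N(u₀)^n = N(u₀)^(m n)`
  have h2 := congrArg (normUnits v) hpow
  rw [map_pow, normUnits_liftUnits, map_pow, map_zpow, ← zpow_natCast, ← zpow_natCast, ← zpow_mul] at h2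
  have hinj := injective_zpow_iff_not_isOfFinOrder.mpr (not_isOfFinOrder_normUnits_uZero v)
  have h3 : (n : ℤ) = m * n := hinj h2
  exact (Int.eq_one_of_mul_eq_self_left (by exact_mod_cast hn.ne') h3.symm)

/-- **No integer scalar `m ≠ 1` lies in print's (Ind1) strip part** (Galois logarithm). [claim: Mochizuki2012, status: disputed] -/
theorem eq_one_of_zsmul_mem_ind1StripOf {ψ : v.adicCompletion F ≃+ v.adicCompletion F} (m : ℤ)
    (hψm : ∀ a, ψ a = m • a) (hψ : ψ ∈ ind1StripOf v (galoisLog v)) : m = 1 := by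
  obtain ⟨-, -, φ, hr⟩ := hψ
  exact eq_one_of_realises_zsmul v m hψm hr

/-- **`−1 ∉ Real.ind1StripOf v (galoisLog v)`** — print's (Ind1) strip part at a finite place does NOT contain the
inversion, in CONTRAST with print's (Ind2) (`Real.neg_mem_ismIsmOf`: `−1 ∈ Real.ismIsmOf v L` for every `L`) and with
Dupuy–Hilado's `Aut_{ℚ_p}(K_v : I_v)` (`Real.neg_mem_ismDH_inr`). [claim: Mochizuki2012, status: disputed] -/
theorem neg_not_mem_ind1StripOf : AddEquiv.neg (v.adicCompletion F) ∉ ind1StripOf v (galoisLog v) := by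
  intro h
  have h1 := eq_one_of_zsmul_mem_ind1StripOf v (-1) (fun a => by rw [AddEquiv.neg_apply, neg_one_zsmul]) h
  omega

/-! ## 5. [IUTchII] Remark 1.8.1 at the real log-shell: (Ind1)-strip ∩ (Ind2)-`Ẑ^×`-scalars is trivial -/

/-- **[IUTchII] Rmk. 1.8.1 at the real log-shell.**  If the `Ẑ^×`-SCALAR `χ_p(û) · (−)` on `K_v` — an element of print's
(Ind2) for the Galois logarithm (gen 7 `Real.mulPadicUnitScalar_mem_ismIsmOf`, [IUTchII] Ex. 1.8 (iv) «`Ẑ^× ↠ ℤ_p^× ↪ Ism`») —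
ALSO lies in print's (Ind1) strip part for the Galois logarithm, then `χ_p(û) = 1` in `K_v`: «no automorphism of `O^{×μ}(G)`
induced by an element of `Aut(G)` … coincides with an automorphism of `O^{×μ}(G)` induced by an element of `Γ` that has
nontrivial image in `ℤ_p^×`» (kurims p. 41), on the `G_v`-invariant part.  Proof (abc-iut-L6-d2's, on `𝒪_v^×`): at
`u₀ = 1 + p_v`, `log(β u₀) = χ_p(û)·log u₀ = log s'` for a `p_v`-adic unit `s'`; so `(β u₀)ⁿ = s'ⁿ`, and norm rigidity gives
`(1+p_v)^{dn} = s'^{dn}`, whence `log(1+p_v) = log s' = χ_p(û)·log(1+p_v)` with `log(1+p_v) ≠ 0`.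
[claim: Mochizuki2012, status: disputed] -/
theorem padicUnitScalar_eq_one_of_mem_ind1StripOf (û : ZHatUnits)
    (h : mulPadicUnitScalar v û ∈ ind1StripOf v (galoisLog v)) : padicUnitScalar v û = 1 := by
  haveI : CharZero (v.adicCompletion F) := charZero_adicCompletion v
  haveI : CharZero (AlgebraicClosure (v.adicCompletion F)) :=
    charZero_of_injective_algebraMap (algebraMap (v.adicCompletion F) _).injective
  letI := padicAlg v
  obtain ⟨-, -, φ, hr⟩ := h
  rw [realises_stripMulAut_iff] at hr
  -- notation
  set C := closureAt v with hC
  set p := C.residueChar with hp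
  set ι := algebraMap (v.adicCompletion F) (AlgebraicClosure (v.adicCompletion F)) with hι
  set β := liftUnits v φ with hβ
  -- (1) `log(ι β u₀) = χ·log(ι u₀)` with `ι u₀ = padicScalar s₀`
  have E1 : C.galoisPadicLog.log (ι ((β (uZero v) : ↥(v.adicCompletionIntegers F)) : v.adicCompletion F)) =
      C.padicScalar (ZHatLevel.padicChar p û) * C.galoisPadicLog.log (C.padicScalar (sZero v : ℤ_[p])) := by
    rw [← algebraMap_uZero, hι, ← algebraMap_galoisLog, ← algebraMap_galoisLog, ← hr (uZero v), mulPadicUnitScalar_apply,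
      map_mul, padicScalar_padicChar]
  -- (2) `χ·log(padicScalar s₀) = log(padicScalar s')`
  obtain ⟨s', hs'⟩ := C.exists_padicUnit_log_eq_mul (sZero v) (ZHatLevel.padicChar p û)
  -- `padicScalar s' = ι t'`, `t'` a unit of `K_v`, `= u'`
  set t' : v.adicCompletion F := LocalField.padicRingHom (v.adicCompletion F) p C.valuation_ringChar_lt_one
    ((s' : ℤ_[p]) : ℚ_[p]) with ht'
  have ht'ι : ι t' = C.padicScalar (s' : ℤ_[p]) := rfl
  have ht'v : ValuativeRel.valuation (v.adicCompletion F) t' = 1 :=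
    C.valuation_padicRingHom_units_eq_one p C.valuation_ringChar_lt_one s'
  have ht'0 : t' ≠ 0 := fun h0 => by rw [h0, map_zero] at ht'v; exact zero_ne_one ht'v
  obtain ⟨u', hu'⟩ := exists_unit_coe_eq (x := Units.mk0 t' ht'0) (by rw [Valuation.mem_unitGroup_iff]; exact ht'v)
  have hu'c : ((u' : ↥(v.adicCompletionIntegers F)) : v.adicCompletion F) = t' := by
    have h' := congrArg (fun w : (v.adicCompletion F)ˣ => (w : v.adicCompletion F)) hu'
    simpa only [coe_unitsToK, Units.val_mk0] using h'
  -- (3) `log (β u₀) = log u'` in `K_v`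
  have E2 : galoisLog v (Additive.ofMul (β (uZero v))) = galoisLog v (Additive.ofMul u') := by
    apply (algebraMap (v.adicCompletion F) (AlgebraicClosure (v.adicCompletion F))).injective
    rw [algebraMap_galoisLog, algebraMap_galoisLog, hu'c, ← hι, ht'ι, hs', ← E1]
  -- (4) `(β u₀)^n = u'^n`, norms: `N(u₀)^n = N(u')^n`
  obtain ⟨n, hn, hpow⟩ := exists_pow_eq_of_galoisLog_eq v E2
  have hN := congrArg (fun w : (↥(v.adicCompletionIntegers F))ˣ =>
    normQp v ((w : ↥(v.adicCompletionIntegers F)) : v.adicCompletion F)) hpow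
  simp only [Units.val_pow_eq_pow_val, SubmonoidClass.coe_pow, map_pow] at hN
  rw [hβ, norm_liftUnits, normQp_uZero, hu'c, ht',
    show (LocalField.padicRingHom (v.adicCompletion F) p C.valuation_ringChar_lt_one ((s' : ℤ_[p]) : ℚ_[p])) =
      algebraMap ℚ_[p] (v.adicCompletion F) ((s' : ℤ_[p]) : ℚ_[p]) from rfl] at hN
  change _ = (Algebra.norm ℚ_[p] (algebraMap ℚ_[p] (v.adicCompletion F) ((s' : ℤ_[p]) : ℚ_[p]))) ^ n at hN
  rw [Algebra.norm_algebraMap, ← pow_mul, ← pow_mul] at hN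
  -- (5) in `K̄_v`: `(padicScalar s₀)^(d n) = (padicScalar s')^(d n)`, then logs
  set d := Module.finrank ℚ_[p] (v.adicCompletion F) with hd
  have hdn : d * n ≠ 0 := Nat.mul_ne_zero (finrank_padicAlg_pos v).ne' hn.ne'
  have hK : (C.padicScalar (sZero v : ℤ_[p])) ^ (d * n) = (C.padicScalar (s' : ℤ_[p])) ^ (d * n) := by
    rw [MLFClosure.padicScalar_apply, MLFClosure.padicScalar_apply, ← map_pow, ← map_pow, ← map_pow, ← map_pow]
    exact congrArg _ (congrArg _ hN)
  have hs₀U := C.padicScalar_units_mem_unitSubmonoid (sZero v)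
  have hs'U := C.padicScalar_units_mem_unitSubmonoid s'
  have hlog : C.galoisPadicLog.log (C.padicScalar (sZero v : ℤ_[p])) = C.galoisPadicLog.log (C.padicScalar (s' : ℤ_[p])) := by
    have hh := congrArg C.galoisPadicLog.log hK
    rw [C.galoisPadicLog.log_pow hs₀U, C.galoisPadicLog.log_pow hs'U] at hh
    exact smul_right_injective _ hdn hh
  -- (6) `log s₀ = χ · log s₀` with `log s₀ ≠ 0`
  have hne : C.galoisPadicLog.log (C.padicScalar (sZero v : ℤ_[p])) ≠ 0 := by
    rw [coe_sZero]
    exact C.log_one_add_residueChar_ne_zero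
  have hχ : C.padicScalar (ZHatLevel.padicChar p û) = 1 := by
    have hh := hs'
    rw [← hlog] at hh
    exact (mul_left_eq_self₀.mp hh.symm).resolve_right hne
  -- (7) read `χ_p(û) = 1` back in `K_v`
  apply (algebraMap (v.adicCompletion F) (AlgebraicClosure (v.adicCompletion F))).injective
  rw [map_one, ← padicScalar_padicChar]
  exact hχ

/-- Hence such a scalar acts trivially: `mulPadicUnitScalar v û = 1`. [claim: Mochizuki2012, status: disputed] -/
theorem mulPadicUnitScalar_eq_refl_of_mem_ind1StripOf (û : ZHatUnits)
    (h : mulPadicUnitScalar v û ∈ ind1StripOf v (galoisLog v)) :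
    mulPadicUnitScalar v û = AddEquiv.refl (v.adicCompletion F) := by
  apply AddEquiv.ext
  intro a
  rw [mulPadicUnitScalar_apply, padicUnitScalar_eq_one_of_mem_ind1StripOf v û h, one_mul]
  rfl

end Scalars

end Summit.ABC.IUTFork.Thm311.Real

end
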